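import Literature.Probability.LatticeModels.CriticalWickDichotomy
import Literature.Probability.LatticeModels.CriticalTwoPointBounds
import HarnessLib

/-!
# Objects of the line `only-interaction-breaks-moebius` for the crux `MoebiusLimitExists`
(item stmt-CriticalPhenomena-1344; `Summit.CriticalPhenomena.Ising3DConformalLimit.Theses.PerfectScreening.MoebiusLimitExists`
= `…Theses.EnergyNotSigmaSquared.MoebiusLimit`, one term)

Route-posited objects (D-0016: definitions a route/line posits live in a reviewed `…Defs` file, never
inside a proof file). The line (checked skeleton `Cruxes/MoebiusLimitExists/Lines/only-interaction-breaks-moebius.lean`,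
lead `prover-line-stmt-CriticalPhenomena-1344-0`) pins the renormalisation of the critical `ℤ³` spin
correlators at `ρ_pin(δ) := ⟨σ₀ σ_{⌊1/δ⌋ e₀}⟩_{β_c}^{-1/2}` and studies the CLUSTER POINTS of the pinned
zoom: locally uniform limits, off the diagonals, of `ρ_pin(δ)ⁿ ⟨σ_{[x₁/δ]} ⋯ σ_{[xₙ/δ]}⟩_{β_c}` along one
mesh sequence `δ = u_k → 0⁺` for all `n` at once. On the free stratum (`U₄ ≡ 0`) a cluster point is the
Wick (generalised-free, mean-field) family `wickPower Δ` of the pure power `‖x − y‖^{-2Δ}`.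

Contents: `rhoPin`, `IsClusterPoint`, `IsNormalised`, `IsRegular`, `powerKernel`, `wickPower`,
`PinnedLimit`, and their elementary API (`rhoPin_pos`, `isClusterPoint_of_subseq`, the values of
`wickPower` off `NonCoincident`, at odd orders and at even orders, non-degeneracy from the two-point
law). Everything here is definitional bookkeeping; the mathematics of the line is in the stub files
`Theorems/EnergyNotSigmaSquaredMoebiusLimitExists*.lean` that import this module.

References: the pinned renormalisation and the cluster-set schema are folklore (subsequence principle
`Literature.Barriers.CriticalPhenomena.hasPointwiseScalingLimit_of_seq_subseq`); the Wick family of a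
pure power is the generalised free field of Di Francesco–Mathieu–Sénéchal 1997, §4.3.1; the Gaussian
pairing functional `pairingSum` is the tree's (`HighDimTrivialityWick`).
-/

noncomputable section

open Filter Topology Set Function
open Literature.Probability.LatticeModels

namespace Summit.CriticalPhenomena.Ising3DConformalLimit.MoebiusLimitExistsOnlyInteraction

/-- The PINNED renormalisation `ρ_pin(δ) := ⟨σ₀ σ_{⌊1/δ⌋ e₀}⟩_{β_c}^{-1/2}` of the critical `ℤ³`
correlators: `ρ_pin(δ)² ⟨σ_{[0/δ]} σ_{[e₀/δ]}⟩_{β_c} = 1`, so no killing or exploding renormalisation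
occurs. [folklore] -/
def rhoPin (δ : ℝ) : ℝ :=
  (criticalTwoPoint 3 (Pi.single 0 (⌊1 / δ⌋ : ℤ))) ^ (-(1 / 2 : ℝ))

/-- `S` is a CLUSTER POINT of the pinned zoom: along some mesh sequence `u k → 0⁺` the pinned
rescaled critical correlators converge to `S n` locally uniformly on the non-coincident
configurations, for every `n` (ONE sequence for all `n`). [folklore] -/
def IsClusterPoint (S : CorrFamily 3) : Prop :=
  ∃ u : ℕ → ℝ, Tendsto u atTop (𝓝[>] (0 : ℝ)) ∧
    ∀ n, TendstoLocallyUniformlyOn (fun k => rescaledCorrelator (criticalCorr 3) rhoPin n (u k))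
      (S n) atTop (NonCoincident 3 n)

/-- `S` is NORMALISED: it vanishes off the non-coincident configurations (without loss of generality
for the crux, whose clauses only read `S` on `NonCoincident`). [folklore] -/
def IsNormalised (S : CorrFamily 3) : Prop :=
  ∀ n (x : Fin n → EuclideanSpace ℝ (Fin 3)), x ∉ NonCoincident 3 n → S n x = 0

/-- A REGULAR family: normalised, continuous off the diagonals, translation invariant. [folklore] -/
def IsRegular (S : CorrFamily 3) : Prop :=
  IsNormalised S ∧ (∀ n, ContinuousOn (S n) (NonCoincident 3 n)) ∧ IsTranslationInvariant S

/-- The pure-power two-point kernel `‖p − q‖^{-2Δ}` on `ℝ³`. [folklore] -/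
def powerKernel (Δ : ℝ) (p q : EuclideanSpace ℝ (Fin 3)) : ℝ :=
  ‖p - q‖ ^ (-(2 * Δ))

open Classical in
/-- The normalised WICK FAMILY `W_Δ` of the pure power `‖p − q‖^{-2Δ}` (the generalised free field of
dimension `Δ`, Di Francesco–Mathieu–Sénéchal 1997 §4.3.1): on non-coincident configurations of even
length `2m` the Gaussian pairing functional `𝒢_m[‖·−·‖^{-2Δ}]` (`pairingSum`), zero at odd length and
off `NonCoincident`. [folklore] -/
def wickPower (Δ : ℝ) : CorrFamily 3 := fun n x =>
  if x ∈ NonCoincident 3 n then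
    (if h : 2 * (n / 2) = n then pairingSum (powerKernel Δ) (n / 2) (fun i => x (Fin.cast h i)) else 0)
  else 0

/-- A PINNED LIMIT with exponent `Δ`: the three contentful clauses of the crux for the pinned
renormalisation `ρ = ρ_pin` (pointwise scaling limit, non-degenerate two-point function, Möbius
covariance with dimension `Δ`). [folklore] -/
def PinnedLimit (Δ : ℝ) (S : CorrFamily 3) : Prop :=
  HasPointwiseScalingLimit (criticalCorr 3) rhoPin S ∧ IsNondegenerateTwoPoint S ∧ IsMoebiusCovariant Δ S

/-! ### Elementary API -/

/-- `ρ_pin > 0` on `(0,1]`: `⟨σ₀σ_x⟩_{β_c} ≥ c‖x‖⁻² > 0` for `x ≠ 0` (`criticalTwoPoint_bounds_holds`,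
Duminil-Copin 2019 Thm. 4.8) and `⌊1/δ⌋ ≥ 1` for `δ ∈ (0,1]`. [folklore] -/
theorem rhoPin_pos : ∀ δ ∈ Set.Ioc (0 : ℝ) 1, 0 < rhoPin δ := by
  intro δ hδ
  unfold rhoPin
  apply Real.rpow_pos_of_pos
  obtain ⟨c, C, hc, hb⟩ := criticalTwoPoint_bounds_holds (d := 3) le_rfl
  have hm1 : (1 : ℤ) ≤ ⌊1 / δ⌋ := Int.le_floor.2 (by
    rw [Int.cast_one]
    exact one_le_one_div hδ.1 hδ.2)
  have hx : (Pi.single 0 (⌊1 / δ⌋ : ℤ) : Site 3) ≠ 0 := by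
    intro h
    have h0 := congr_fun h 0
    simp only [Pi.single_eq_same, Pi.zero_apply] at h0
    omega
  have hpos : 0 < c * (‖(Pi.single 0 (⌊1 / δ⌋ : ℤ) : Site 3)‖ : ℝ) ^ (-((3 : ℝ) - 1)) :=
    mul_pos hc (Real.rpow_pos_of_pos (norm_pos_iff.2 hx) _)
  exact lt_of_lt_of_le hpos (hb _ hx).1

/-- A subsequential limit of the pinned zoom along `u ∘ φ` (`u k → 0⁺`, `φ` strictly increasing) is a
cluster point. [folklore] -/
theorem isClusterPoint_of_subseq {u : ℕ → ℝ} (hu : Tendsto u atTop (𝓝[>] (0 : ℝ))) {φ : ℕ → ℕ}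
    (hφ : StrictMono φ) {S : CorrFamily 3}
    (hconv : ∀ n, TendstoLocallyUniformlyOn
      (fun k => rescaledCorrelator (criticalCorr 3) rhoPin n (u (φ k))) (S n) atTop
      (NonCoincident 3 n)) :
    IsClusterPoint S :=
  ⟨u ∘ φ, hu.comp hφ.tendsto_atTop, hconv⟩

/-- The power kernel is symmetric. [folklore] -/
theorem powerKernel_comm (Δ : ℝ) (p q : EuclideanSpace ℝ (Fin 3)) :
    powerKernel Δ p q = powerKernel Δ q p := by
  unfold powerKernel
  rw [norm_sub_rev]

/-- `wickPower Δ` vanishes off `NonCoincident` (it is normalised). [folklore] -/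
theorem wickPower_of_not_mem {Δ : ℝ} {n : ℕ} {x : Fin n → EuclideanSpace ℝ (Fin 3)}
    (hx : x ∉ NonCoincident 3 n) : wickPower Δ n x = 0 := by
  unfold wickPower
  rw [if_neg hx]

/-- `wickPower Δ` is normalised. [folklore] -/
theorem isNormalised_wickPower (Δ : ℝ) : IsNormalised (wickPower Δ) :=
  fun _ _ hx => wickPower_of_not_mem hx

/-- `wickPower Δ` vanishes at odd orders. [folklore] -/
theorem wickPower_of_odd {Δ : ℝ} {n : ℕ} (hn : Odd n) (x : Fin n → EuclideanSpace ℝ (Fin 3)) :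
    wickPower Δ n x = 0 := by
  unfold wickPower
  by_cases hx : x ∈ NonCoincident 3 n
  · rw [if_pos hx, dif_neg]
    obtain ⟨k, rfl⟩ := hn
    omega
  · rw [if_neg hx]

/-- `wickPower Δ` at even order `2m` on a non-coincident configuration is the pairing functional of the
power kernel. [folklore] -/
theorem wickPower_of_mem_even {Δ : ℝ} {m : ℕ} {x : Fin (2 * m) → EuclideanSpace ℝ (Fin 3)}
    (hx : x ∈ NonCoincident 3 (2 * m)) : wickPower Δ (2 * m) x = pairingSum (powerKernel Δ) m x := by
  unfold wickPower
  have h : 2 * (2 * m / 2) = 2 * m := by omega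
  rw [if_pos hx, dif_pos h]
  have e : 2 * m / 2 = m := by omega
  have := pairingSum_comp_cast (powerKernel Δ) x h rfl e
  simpa [Function.comp_def] using this

/-- `wickPower Δ 0 = 1` (the empty pairing). [folklore] -/
theorem wickPower_zero (Δ : ℝ) (x : Fin 0 → EuclideanSpace ℝ (Fin 3)) : wickPower Δ 0 x = 1 := by
  have hx : x ∈ NonCoincident 3 (2 * 0) := by
    rw [mem_nonCoincident]
    intro i
    exact Fin.elim0 i
  have h := wickPower_of_mem_even (Δ := Δ) (m := 0) hx
  rw [pairingSum_zero] at h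
  exact h

/-- `wickPower Δ 2 (p, q) = ‖p − q‖^{-2Δ}` for `p ≠ q`. [folklore] -/
theorem wickPower_two {Δ : ℝ} {x : Fin 2 → EuclideanSpace ℝ (Fin 3)} (hx : x ∈ NonCoincident 3 2) :
    wickPower Δ 2 x = ‖x 0 - x 1‖ ^ (-(2 * Δ)) := by
  have h := wickPower_of_mem_even (Δ := Δ) (m := 1) (x := x) hx
  rw [pairingSum_one _ (powerKernel_comm Δ)] at h
  exact h

/-- Under the pure-power two-point law a family is non-degenerate: `S₂ = ‖x₀ − x₁‖^{-2Δ} > 0` off the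
diagonal. [folklore] -/
theorem isNondegenerateTwoPoint_of_twoPoint {Δ : ℝ} {S : CorrFamily 3}
    (h2 : ∀ x ∈ NonCoincident 3 2, S 2 x = ‖x 0 - x 1‖ ^ (-(2 * Δ))) :
    IsNondegenerateTwoPoint S := by
  intro x hx
  rw [h2 x hx]
  refine Real.rpow_pos_of_pos (norm_pos_iff.2 (sub_ne_zero.2 ?_)) _
  exact ((mem_nonCoincident x).1 hx).ne (by decide)

end Summit.CriticalPhenomena.Ising3DConformalLimit.MoebiusLimitExistsOnlyInteraction

end
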